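import Mathlib
import Summits.NavierStokesRegularity.NavierStokesRegularity.Theorems.FilamentSkeletonRssKelvinGateFreePressure
import Summits.NavierStokesRegularity.NavierStokesRegularity.Theorems.FilamentSkeletonRssKelvinGatePressureDecayK
import Summits.NavierStokesRegularity.NavierStokesRegularity.Theorems.FilamentSkeletonRssKelvinGatePressureHolder
import Literature.Analysis.FluidPDE.WholeSpaceIBP
import Literature.Analysis.FluidPDE.PressurePoisson

/-!
# Route `FilamentSkeletonRss` · crux `TransverseReduction1A` (stmt-27414; successor of the aside `TransverseReductionRJ`,
# stmt-21221) — line `kelvin_gate`: the PROJECTED DATUM `G = F − ∇Q` of a sharp `Y`-field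

Helper file (theorems only, `--as helper`).  HONEST FRAMING: analysis bookkeeping for a HYPOTHETICAL filament-type rotating
self-similar blow-up route; nothing here bears on Navier–Stokes regularity; no stub is proved here.

For a forcing `F ∈ C¹(ℝ³; ℝ³)` of the SHARP `Y`-scale of weight `a + 1`, `1 < a < 2`
(`(1+|y|)^{a+1}‖F‖ ≤ R`, `(1+|y|)^{a+1}‖DF‖ ≤ R`), the free pressure is `Q = Σⱼ T_{eⱼ}Fⱼ` (`…KelvinGateFreePressure`;
written out, no definitions) and the PROJECTED DATUM is `G = F − ∇Q`.  This file proves what the Ornstein–Uhlenbeck resolvent on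
weight-`a` data (`…KelvinGateFreeResolventWeighted.free_resolvent_weighted`) consumes:

* `fderiv_freePressure_eq_sum` — `DQ = Σⱼ T_{eⱼ}(DFⱼ)` (derivative on the density);
* `rpow_weight_norm_fderiv_freePressure_le` — `(1+|x|)^a ‖DQ(x)‖ ≤ C_D R`: SUBCRITICAL decay from kernel SIZE at data weight
  `a + 1 ∈ (2, 3)` (`…KelvinGatePressureDecayK`);
* `rpow_weight_norm_fderiv_freePressure_sub_le` — the `⟨x⟩^a`-weighted LOCAL `½`-Hölder modulus of `DQ` from kernel SMOOTHNESS
  (`…KelvinGatePressureHolder`, with a size bound in the intermediate range `(1+|x|)/4 < |z−x| ≤ (1+|x|)/2`);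
* `projected_datum` — **package**: `∃ C(a) ∀ F R`: `Q ∈ C¹`, `|Q| ≤ C R`, `(1+|x|)^a‖∇Q‖ ≤ C R`; `G` is continuous,
  `(1+|x|)^a‖G‖ ≤ C R`, `(1+|x|)^a‖G z − G x‖ ≤ C R |z−x|^{1/2}` for `2|z−x| ≤ 1+|x|`, and `G` is WEAKLY DIVERGENCE FREE
  (`∫⟨G, ∇θ⟩ = 0` for test `θ`: `∫⟨F,∇θ⟩ = −∫θ div F`, `∫⟨∇Q,∇θ⟩ = −∫QΔθ = −∫θ div F` by `ΔQ = div F` in `𝒟′`).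
-/

set_option linter.dupNamespace false

noncomputable section

namespace Summit.NavierStokesRegularity.NavierStokesRegularity.Theorems.KelvinGate

open Set Function Filter MeasureTheory Metric Real InnerProductSpace
open Literature.Analysis.FluidPDE Literature.Analysis.FluidPDE.NewtonPotentialHolder
open scoped ENNReal Topology Laplacian RealInnerProductSpace BigOperators

section Projected

variable {F : EuclideanSpace ℝ (Fin 3) → EuclideanSpace ℝ (Fin 3)} {a R : ℝ}

/-! ## Weights -/

/-- `(1+|y|)² ≤ (1+|y|)^{a+1}` for `1 ≤ a`. -/
theorem sq_weight_le_rpow_weight (ha : 1 ≤ a) (y : EuclideanSpace ℝ (Fin 3)) : (1 + ‖y‖) ^ 2 ≤ (1 + ‖y‖) ^ (a + 1) := by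
  have h1 : 1 ≤ 1 + ‖y‖ := by linarith [norm_nonneg y]
  calc (1 + ‖y‖) ^ 2 = (1 + ‖y‖) ^ (2:ℝ) := by norm_cast
    _ ≤ (1 + ‖y‖) ^ (a + 1) := Real.rpow_le_rpow_of_exponent_le h1 (by linarith)

/-- A weight-`(a+1)` bound implies the quadratic-weight bound of the `Y`-scale files. -/
theorem sq_weight_mul_norm_le_of_rpow_weight {V : Type*} [NormedAddCommGroup V] {f : EuclideanSpace ℝ (Fin 3) → V}
    (ha : 1 ≤ a) (h : ∀ y, (1 + ‖y‖) ^ (a + 1) * ‖f y‖ ≤ R) (y : EuclideanSpace ℝ (Fin 3)) :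
    (1 + ‖y‖) ^ 2 * ‖f y‖ ≤ R :=
  le_trans (mul_le_mul_of_nonneg_right (sq_weight_le_rpow_weight ha y) (norm_nonneg _)) (h y)

/-- The coordinate derivatives inherit a weight-`k` bound: `(1+|y|)^k ‖DFⱼ(y)‖ ≤ R`. -/
theorem rpow_weight_norm_fderiv_coord_le (hF : ContDiff ℝ 1 F) {k : ℝ} (h1 : ∀ y, (1 + ‖y‖) ^ k * ‖fderiv ℝ F y‖ ≤ R)
    (j : Fin 3) (y : EuclideanSpace ℝ (Fin 3)) :
    (1 + ‖y‖) ^ k * ‖fderiv ℝ (fun y => F y j) y‖ ≤ R := by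
  rw [fderiv_coord hF j y]
  have hp : ‖(EuclideanSpace.proj (𝕜 := ℝ) j : EuclideanSpace ℝ (Fin 3) →L[ℝ] ℝ)‖ ≤ 1 := by
    refine ContinuousLinearMap.opNorm_le_bound _ zero_le_one fun v => ?_
    rw [one_mul]
    simpa using PiLp.norm_apply_le v j
  have h : ‖(EuclideanSpace.proj (𝕜 := ℝ) j).comp (fderiv ℝ F y)‖ ≤ ‖fderiv ℝ F y‖ :=
    (ContinuousLinearMap.opNorm_comp_le _ _).trans (by nlinarith [norm_nonneg (fderiv ℝ F y)])
  exact le_trans (mul_le_mul_of_nonneg_left h (by positivity)) (h1 y)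

/-! ## The gradient of the free pressure: formula, decay, local Hölder modulus -/

/-- **`DQ(x) = Σⱼ T_{eⱼ}(DFⱼ)(x)`** (the derivative falls on the density; quadratic weights suffice). -/
theorem fderiv_freePressure_eq_sum (hF : ContDiff ℝ 1 F) {R₀ R₁ : ℝ} (h0 : ∀ y, (1 + ‖y‖) ^ 2 * ‖F y‖ ≤ R₀)
    (h1 : ∀ y, (1 + ‖y‖) ^ 2 * ‖fderiv ℝ F y‖ ≤ R₁) (x : EuclideanSpace ℝ (Fin 3)) :
    fderiv ℝ (fun x => ∑ j : Fin 3, newtonGradPotential (EuclideanSpace.single j (1:ℝ)) (fun y => F y j) x) x =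
      ∑ j : Fin 3, newtonGradPotential (EuclideanSpace.single j (1:ℝ)) (fderiv ℝ (fun y => F y j)) x := by
  have h0' : ∀ j : Fin 3, ∀ y, (1 + ‖y‖) ^ 2 * ‖F y j‖ ≤ R₀ := fun j y => by
    rw [Real.norm_eq_abs]; exact sq_weight_abs_coord_le h0 j y
  have hd : ∀ j ∈ (Finset.univ : Finset (Fin 3)), DifferentiableAt ℝ
      (newtonGradPotential (EuclideanSpace.single j (1:ℝ)) (fun y => F y j)) x := fun j _ =>
    (hasFDerivAt_newtonGradPotential_of_sq_weight (contDiff_coord hF j) (h0' j)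
      (sq_weight_norm_fderiv_coord_le hF h1 j) _ x).differentiableAt
  rw [fderiv_fun_sum hd]
  exact Finset.sum_congr rfl fun j _ =>
    (hasFDerivAt_newtonGradPotential_of_sq_weight (contDiff_coord hF j) (h0' j) (sq_weight_norm_fderiv_coord_le hF h1 j) _ x).fderiv

/-- **Subcritical decay of the free pressure gradient**: for `1 < a < 2`, with `C_a = 2^a + 4·2^{2−a}/(2−a) + 4·2^{−a}/a` and
`V = 3|B₁|`, `(1+|x|)^a ‖DQ(x)‖ ≤ 3 (R/4π) C_a V` whenever `(1+|y|)^{a+1}‖F‖, (1+|y|)^{a+1}‖DF‖ ≤ R`. -/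
theorem rpow_weight_norm_fderiv_freePressure_le (ha1 : 1 < a) (ha2 : a < 2) (hF : ContDiff ℝ 1 F)
    (h0 : ∀ y, (1 + ‖y‖) ^ (a + 1) * ‖F y‖ ≤ R) (h1 : ∀ y, (1 + ‖y‖) ^ (a + 1) * ‖fderiv ℝ F y‖ ≤ R)
    (x : EuclideanSpace ℝ (Fin 3)) :
    (1 + ‖x‖) ^ a * ‖fderiv ℝ (fun x => ∑ j : Fin 3, newtonGradPotential (EuclideanSpace.single j (1:ℝ))
        (fun y => F y j) x) x‖ ≤
      3 * (R / (4 * π) * (((2:ℝ) ^ a + 4 * (2:ℝ) ^ (2 - a) / (2 - a) + 4 * (2:ℝ) ^ (-a) / a) *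
        (3 * (volume : Measure (EuclideanSpace ℝ (Fin 3))).real (ball 0 1)))) := by
  have hk2 : 2 ≤ a + 1 := by linarith
  have hk3 : a + 1 < 3 := by linarith
  have hx : 0 < (1 + ‖x‖) ^ a := by positivity
  rw [fderiv_freePressure_eq_sum hF (sq_weight_mul_norm_le_of_rpow_weight ha1.le h0)
    (sq_weight_mul_norm_le_of_rpow_weight ha1.le h1) x]
  have hj : ∀ j : Fin 3, (1 + ‖x‖) ^ a * ‖newtonGradPotential (EuclideanSpace.single j (1:ℝ)) (fderiv ℝ (fun y => F y j)) x‖ ≤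
      R / (4 * π) * (((2:ℝ) ^ a + 4 * (2:ℝ) ^ (2 - a) / (2 - a) + 4 * (2:ℝ) ^ (-a) / a) *
        (3 * (volume : Measure (EuclideanSpace ℝ (Fin 3))).real (ball 0 1))) := by
    intro j
    have h := norm_newtonGradPotential_le_of_weight_rpow hk2 hk3 (rpow_weight_norm_fderiv_coord_le hF h1 j)
      (EuclideanSpace.single j (1:ℝ)) x
    have e : ‖EuclideanSpace.single j (1:ℝ)‖ = 1 := by simp
    rw [e, one_mul, show a + 1 - 1 = a by ring, show 3 - (a + 1) = 2 - a by ring, show 1 - (a + 1) = -a by ring] at h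
    have hw : (1 + ‖x‖) ^ a * (1 + ‖x‖) ^ (-a) = 1 := by
      rw [← Real.rpow_add (by positivity), add_neg_cancel, Real.rpow_zero]
    calc (1 + ‖x‖) ^ a * ‖newtonGradPotential (EuclideanSpace.single j (1:ℝ)) (fderiv ℝ (fun y => F y j)) x‖
        ≤ (1 + ‖x‖) ^ a * (R / (4 * π) * (((2:ℝ) ^ a + 4 * (2:ℝ) ^ (2 - a) / (2 - a) + 4 * (2:ℝ) ^ (-a) / a) *
          (3 * (volume : Measure (EuclideanSpace ℝ (Fin 3))).real (ball 0 1)) * (1 + ‖x‖) ^ (-a))) :=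
          mul_le_mul_of_nonneg_left h hx.le
      _ = _ := by
          rw [show ∀ A B : ℝ, (1 + ‖x‖) ^ a * (A * (B * (1 + ‖x‖) ^ (-a))) = A * B * ((1 + ‖x‖) ^ a * (1 + ‖x‖) ^ (-a))
            from fun A B => by ring, hw, mul_one]
  calc (1 + ‖x‖) ^ a * ‖∑ j : Fin 3, newtonGradPotential (EuclideanSpace.single j (1:ℝ)) (fderiv ℝ (fun y => F y j)) x‖
      ≤ (1 + ‖x‖) ^ a * ∑ j : Fin 3, ‖newtonGradPotential (EuclideanSpace.single j (1:ℝ)) (fderiv ℝ (fun y => F y j)) x‖ :=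
        mul_le_mul_of_nonneg_left (norm_sum_le _ _) hx.le
    _ = ∑ j : Fin 3, (1 + ‖x‖) ^ a * ‖newtonGradPotential (EuclideanSpace.single j (1:ℝ)) (fderiv ℝ (fun y => F y j)) x‖ :=
        Finset.mul_sum _ _ _
    _ ≤ ∑ _j : Fin 3, R / (4 * π) * (((2:ℝ) ^ a + 4 * (2:ℝ) ^ (2 - a) / (2 - a) + 4 * (2:ℝ) ^ (-a) / a) *
        (3 * (volume : Measure (EuclideanSpace ℝ (Fin 3))).real (ball 0 1))) := Finset.sum_le_sum fun j _ => hj j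
    _ = _ := by rw [Finset.sum_const, Finset.card_univ, Fintype.card_fin]; simp

/-- **Weighted local `½`-Hölder modulus of the free pressure gradient.**  For `1 < a < 2` there is `C ≥ 0` such that for
all `F, R` as above and all `x, z` with `2|z − x| ≤ 1 + |x|`: `(1+|x|)^a ‖DQ(z) − DQ(x)‖ ≤ C R |z − x|^{1/2}`
(kernel smoothness for `4|z−x| ≤ 1+|x|`, kernel size — the decay bound at `z` and at `x` — in between). -/
theorem rpow_weight_norm_fderiv_freePressure_sub_le (ha1 : 1 < a) (ha2 : a < 2) :
    ∃ C : ℝ, 0 ≤ C ∧ ∀ (F : EuclideanSpace ℝ (Fin 3) → EuclideanSpace ℝ (Fin 3)) (R : ℝ), ContDiff ℝ 1 F →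
      (∀ y, (1 + ‖y‖) ^ (a + 1) * ‖F y‖ ≤ R) → (∀ y, (1 + ‖y‖) ^ (a + 1) * ‖fderiv ℝ F y‖ ≤ R) →
      ∀ x z : EuclideanSpace ℝ (Fin 3), 2 * ‖z - x‖ ≤ 1 + ‖x‖ →
        (1 + ‖x‖) ^ a * ‖fderiv ℝ (fun x => ∑ j : Fin 3, newtonGradPotential (EuclideanSpace.single j (1:ℝ))
            (fun y => F y j) x) z -
          fderiv ℝ (fun x => ∑ j : Fin 3, newtonGradPotential (EuclideanSpace.single j (1:ℝ)) (fun y => F y j) x) x‖ ≤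
          C * R * ‖z - x‖ ^ (1 / 2 : ℝ) := by
  have hk2 : 2 ≤ a + 1 := by linarith
  have hk3 : a + 1 < 3 := by linarith
  obtain ⟨C_H, hCH0, hH⟩ := exists_norm_newtonGradPotential_sub_le_of_weight_rpow (G := EuclideanSpace ℝ (Fin 3) →L[ℝ] ℝ)
    hk2 hk3 (by norm_num : (0:ℝ) < 1 / 2) (by norm_num : (1 / 2 : ℝ) < 1)
  -- the decay constant
  set C_D : ℝ := 3 * (1 / (4 * π) * (((2:ℝ) ^ a + 4 * (2:ℝ) ^ (2 - a) / (2 - a) + 4 * (2:ℝ) ^ (-a) / a) *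
    (3 * (volume : Measure (EuclideanSpace ℝ (Fin 3))).real (ball 0 1)))) with hCD
  have hV0 : 0 ≤ 3 * (volume : Measure (EuclideanSpace ℝ (Fin 3))).real (ball 0 1) := by positivity
  have hCD0 : 0 ≤ C_D := by
    have h2a : 0 < 2 - a := by linarith
    have : 0 ≤ (2:ℝ) ^ a + 4 * (2:ℝ) ^ (2 - a) / (2 - a) + 4 * (2:ℝ) ^ (-a) / a := by positivity
    positivity
  refine ⟨3 * C_H + 10 * C_D, by positivity, ?_⟩
  intro F R hF h0 h1 x z hzx
  have hR : 0 ≤ R := le_trans (by positivity) (h0 0)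
  have hx1 : 0 < 1 + ‖x‖ := by positivity
  have hxa : 0 < (1 + ‖x‖) ^ a := by positivity
  have h0sq := sq_weight_mul_norm_le_of_rpow_weight ha1.le h0
  have h1sq := sq_weight_mul_norm_le_of_rpow_weight ha1.le h1
  -- decay at any point: `(1+|w|)^a ‖DQ(w)‖ ≤ C_D R`
  have hdec : ∀ w, (1 + ‖w‖) ^ a * ‖fderiv ℝ (fun x => ∑ j : Fin 3, newtonGradPotential (EuclideanSpace.single j (1:ℝ))
      (fun y => F y j) x) w‖ ≤ C_D * R := by
    intro w
    have h := rpow_weight_norm_fderiv_freePressure_le ha1 ha2 hF h0 h1 w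
    rw [hCD]
    calc _ ≤ _ := h
      _ = _ := by ring
  by_cases hnear : 4 * ‖z - x‖ ≤ 1 + ‖x‖
  · -- kernel smoothness
    rw [fderiv_freePressure_eq_sum hF h0sq h1sq z, fderiv_freePressure_eq_sum hF h0sq h1sq x, ← Finset.sum_sub_distrib]
    have hxz : 4 * ‖x - z‖ ≤ 1 + ‖x‖ := by rwa [norm_sub_rev]
    have hj : ∀ j : Fin 3, (1 + ‖x‖) ^ a *
        ‖newtonGradPotential (EuclideanSpace.single j (1:ℝ)) (fderiv ℝ (fun y => F y j)) z -
          newtonGradPotential (EuclideanSpace.single j (1:ℝ)) (fderiv ℝ (fun y => F y j)) x‖ ≤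
        C_H * R * ‖z - x‖ ^ (1 / 2 : ℝ) := by
      intro j
      have hm : AEStronglyMeasurable (fderiv ℝ (fun y => F y j)) volume :=
        ((contDiff_coord hF j).continuous_fderiv one_ne_zero).aestronglyMeasurable
      have h := hH hm (rpow_weight_norm_fderiv_coord_le hF h1 j) (EuclideanSpace.single j (1:ℝ)) x z hxz
      have e : ‖EuclideanSpace.single j (1:ℝ)‖ = 1 := by simp
      rw [e, mul_one, show 1 - 1 / 2 - (a + 1) = -a + (-(1 / 2 : ℝ)) by ring, norm_sub_rev x z] at h
      -- `(1+|x|)^a · (1+|x|)^{-a-1/2} = (1+|x|)^{-1/2} ≤ 1`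
      have hw : (1 + ‖x‖) ^ a * (1 + ‖x‖) ^ (-a + (-(1 / 2 : ℝ))) ≤ 1 := by
        rw [← Real.rpow_add hx1, show a + (-a + (-(1 / 2 : ℝ))) = -(1 / 2 : ℝ) by ring]
        exact Real.rpow_le_one_of_one_le_of_nonpos (by linarith [norm_nonneg x]) (by norm_num)
      calc (1 + ‖x‖) ^ a * ‖newtonGradPotential (EuclideanSpace.single j (1:ℝ)) (fderiv ℝ (fun y => F y j)) z -
            newtonGradPotential (EuclideanSpace.single j (1:ℝ)) (fderiv ℝ (fun y => F y j)) x‖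
          = (1 + ‖x‖) ^ a * ‖newtonGradPotential (EuclideanSpace.single j (1:ℝ)) (fderiv ℝ (fun y => F y j)) x -
            newtonGradPotential (EuclideanSpace.single j (1:ℝ)) (fderiv ℝ (fun y => F y j)) z‖ := by rw [norm_sub_rev]
        _ ≤ (1 + ‖x‖) ^ a * (C_H * R * ‖z - x‖ ^ (1 / 2 : ℝ) * (1 + ‖x‖) ^ (-a + (-(1 / 2 : ℝ)))) :=
            mul_le_mul_of_nonneg_left h hxa.le
        _ = C_H * R * ‖z - x‖ ^ (1 / 2 : ℝ) * ((1 + ‖x‖) ^ a * (1 + ‖x‖) ^ (-a + (-(1 / 2 : ℝ)))) := by ring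
        _ ≤ C_H * R * ‖z - x‖ ^ (1 / 2 : ℝ) * 1 := mul_le_mul_of_nonneg_left hw (by positivity)
        _ = _ := mul_one _
    calc (1 + ‖x‖) ^ a * ‖∑ j : Fin 3, (newtonGradPotential (EuclideanSpace.single j (1:ℝ)) (fderiv ℝ (fun y => F y j)) z -
          newtonGradPotential (EuclideanSpace.single j (1:ℝ)) (fderiv ℝ (fun y => F y j)) x)‖
        ≤ (1 + ‖x‖) ^ a * ∑ j : Fin 3, ‖newtonGradPotential (EuclideanSpace.single j (1:ℝ)) (fderiv ℝ (fun y => F y j)) z -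
          newtonGradPotential (EuclideanSpace.single j (1:ℝ)) (fderiv ℝ (fun y => F y j)) x‖ :=
          mul_le_mul_of_nonneg_left (norm_sum_le _ _) hxa.le
      _ = ∑ j : Fin 3, (1 + ‖x‖) ^ a * ‖newtonGradPotential (EuclideanSpace.single j (1:ℝ)) (fderiv ℝ (fun y => F y j)) z -
          newtonGradPotential (EuclideanSpace.single j (1:ℝ)) (fderiv ℝ (fun y => F y j)) x‖ := Finset.mul_sum _ _ _
      _ ≤ ∑ _j : Fin 3, C_H * R * ‖z - x‖ ^ (1 / 2 : ℝ) := Finset.sum_le_sum fun j _ => hj j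
      _ = 3 * C_H * R * ‖z - x‖ ^ (1 / 2 : ℝ) := by
          rw [Finset.sum_const, Finset.card_univ, Fintype.card_fin]; simp; ring
      _ ≤ (3 * C_H + 10 * C_D) * R * ‖z - x‖ ^ (1 / 2 : ℝ) := by
          have : 0 ≤ 10 * C_D * R * ‖z - x‖ ^ (1 / 2 : ℝ) := by positivity
          nlinarith
  · -- kernel size: `(1+|x|)/4 < |z−x| ≤ (1+|x|)/2`
    rw [not_le] at hnear
    have hzw : 1 + ‖x‖ ≤ 2 * (1 + ‖z‖) := by
      have : ‖x‖ ≤ ‖z‖ + ‖z - x‖ := by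
        calc ‖x‖ = ‖z - (z - x)‖ := by rw [sub_sub_cancel]
          _ ≤ ‖z‖ + ‖z - x‖ := norm_sub_le _ _
      linarith
    -- `(1+|x|)^a ≤ 2^a (1+|z|)^a ≤ 4 (1+|z|)^a`
    have hxz : (1 + ‖x‖) ^ a ≤ 4 * (1 + ‖z‖) ^ a := by
      calc (1 + ‖x‖) ^ a ≤ (2 * (1 + ‖z‖)) ^ a := Real.rpow_le_rpow hx1.le hzw (by linarith)
        _ = (2:ℝ) ^ a * (1 + ‖z‖) ^ a := Real.mul_rpow zero_le_two (by positivity)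
        _ ≤ (2:ℝ) ^ (2:ℝ) * (1 + ‖z‖) ^ a :=
            mul_le_mul_of_nonneg_right (Real.rpow_le_rpow_of_exponent_le one_le_two ha2.le) (by positivity)
        _ = 4 * (1 + ‖z‖) ^ a := by norm_num
    -- `1 ≤ 2 |z−x|^{1/2}` since `|z−x| > (1+|x|)/4 ≥ 1/4`
    have hhalf : 1 ≤ 2 * ‖z - x‖ ^ (1 / 2 : ℝ) := by
      have hzx4 : (1 / 4 : ℝ) ≤ ‖z - x‖ := by linarith [norm_nonneg x]
      have h := Real.rpow_le_rpow (by norm_num) hzx4 (by norm_num : (0:ℝ) ≤ 1 / 2)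
      have h14 : (1 / 4 : ℝ) ^ (1 / 2 : ℝ) = 1 / 2 := by
        rw [show (1 / 4 : ℝ) = (1 / 2) ^ 2 by norm_num, ← Real.rpow_natCast, ← Real.rpow_mul (by norm_num)]; norm_num
      rw [h14] at h
      linarith
    set DQ := fderiv ℝ (fun x => ∑ j : Fin 3, newtonGradPotential (EuclideanSpace.single j (1:ℝ)) (fun y => F y j) x) with hDQ
    calc (1 + ‖x‖) ^ a * ‖DQ z - DQ x‖ ≤ (1 + ‖x‖) ^ a * (‖DQ z‖ + ‖DQ x‖) :=
          mul_le_mul_of_nonneg_left (norm_sub_le _ _) hxa.le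
      _ = (1 + ‖x‖) ^ a * ‖DQ z‖ + (1 + ‖x‖) ^ a * ‖DQ x‖ := by ring
      _ ≤ 4 * ((1 + ‖z‖) ^ a * ‖DQ z‖) + (1 + ‖x‖) ^ a * ‖DQ x‖ := by
          nlinarith [mul_le_mul_of_nonneg_right hxz (norm_nonneg (DQ z))]
      _ ≤ 4 * (C_D * R) + C_D * R := add_le_add (mul_le_mul_of_nonneg_left (hdec z) (by norm_num)) (hdec x)
      _ = 5 * C_D * R * 1 := by ring
      _ ≤ 5 * C_D * R * (2 * ‖z - x‖ ^ (1 / 2 : ℝ)) := mul_le_mul_of_nonneg_left hhalf (by positivity)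
      _ = 10 * C_D * R * ‖z - x‖ ^ (1 / 2 : ℝ) := by ring
      _ ≤ (3 * C_H + 10 * C_D) * R * ‖z - x‖ ^ (1 / 2 : ℝ) := by
          have : 0 ≤ 3 * C_H * R * ‖z - x‖ ^ (1 / 2 : ℝ) := by positivity
          nlinarith

end Projected

end Summit.NavierStokesRegularity.NavierStokesRegularity.Theorems.KelvinGate

end
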